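import Summits.AtomisticToContinuum.FouriersLaw.Theorems.PositiveMemory.Negative.NonDegeneracy
import Summits.AtomisticToContinuum.FouriersLaw.Theorems.HonestZwanzigOrthogonalOhmG0PosDef

/-!
# HonestZwanzig / PositiveMemory — fixed-`N` non-degeneracy discharged: `det G₀ ≠ 0`, every orthogonal DC response
# exists, and the crux is EQUIVALENT to its existence-free normal form (line `Sketch`, skeleton v10, stub v10-A)

Support file for crux item `stmt-AtomisticToContinuum-12694` (`HonestZwanzig.PositiveMemory`, sub-problem `FouriersLaw`),
line `Sketch`, registered stub `stub_detG0NeZero` (lead c8, cycle 10, 2026-08-17).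

The refuter's `Negative.ExistenceBarrier` (p126176) proved, MODULO the fixed-`N` hypothesis `det G₀ ≠ 0`
(`G₀ = [∫₀^∞corr(e_x,e_y)]`, the time-integrated equilibrium correlations of the split site energies), that every
orthogonal DC response `ρ_b = lim_{s↓0} schur_s(j_b, J)` of the crux exists and that `PositiveMemory` is equivalent to an
existence-free floor; `Negative.NonDegeneracy` (p126437) identified the hypothesis with `ξ ≠ 0 ⇒ ξᵀG₀ξ > 0`. Crux #2's
line has since LANDED exactly that positivity (`stub_G0PosDef`, `…Theorems.HonestZwanzigOrthogonalOhmG0PosDef`,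
2026-08-17: the bracket induction from the left bath). This file composes the two:

* `stub_detG0NeZero` — `det G₀ ≠ 0` at every admissible parameter point, `T > 0`, `N ≥ 2` (registered signature);
* `tendsto_schur_bond_all` — hence EVERY `ρ_b` exists and equals the explicit finite-`N` Schur complement `schur₀(j_b, J)`;
* `positiveMemory_iff_schur0Floor` — hence, unconditionally, `PositiveMemory ↔ (∃ k₀ > 0, ∃ R, ∀ N ≥ 2, ∀ R-bulk b,
  k₀ ≤ schur₀(j_b, J))`: the crux IS an `N`-uniform positivity statement about explicit finite-`N` Green–Kubo-type
  integrals; its existence guard `∀ ρ, Tendsto … → k₀ ≤ ρ` is no longer a barrier of any kind.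

No definitions, no named facts, no `sorry`.
-/

noncomputable section

open MeasureTheory Finset Real Set Filter Topology
open Literature.MathematicalPhysics.KineticTheory.HeatConduction
open Summit.AtomisticToContinuum.FouriersLaw.Theorems.PositiveMemory.Negative.ExistenceBarrier
open Summit.AtomisticToContinuum.FouriersLaw.Theorems.PositiveMemory.Negative.NonDegeneracy

namespace Summit.AtomisticToContinuum.FouriersLaw.Theorems.HonestZwanzig.PositiveMemory

/-- **Stub v10-A — fixed-`N` non-degeneracy, discharged**: for `pinnedChain ω₂ lam β γ` (all `> 0`), `T > 0`, `N ≥ 2`,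
the matrix `G₀ = [∫₀^∞corr(e_x,e_y)]` of time-integrated site-energy correlations has `det G₀ ≠ 0` — by
`det_G₀_ne_zero_iff` (p126437) it suffices that `ξᵀG₀ξ > 0` for `ξ ≠ 0`, which is the landed `stub_G0PosDef`
(`G(0) ≻ 0`; at `s = 0` the Laplace weight `e^{-0·t}` is `1`). -/
theorem stub_detG0NeZero :
    ∀ ω₂ lam β γ : ℝ, 0 < ω₂ → 0 < lam → 0 < β → 0 < γ → ∀ T : ℝ, 0 < T → ∀ N : ℕ, 2 ≤ N →
    let P := Literature.MathematicalPhysics.KineticTheory.HeatConduction.pinnedChain ω₂ lam β γ;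
    let X := Literature.MathematicalPhysics.KineticTheory.HeatConduction.PhaseSpace N;
    let μ : MeasureTheory.Measure X := P.gibbsMeasure N T;
    let corr : (X → ℝ) → (X → ℝ) → ℝ → ℝ := fun f g t =>
      (∫ z, f z * (∫ y, g y ∂(P.transitionKernel N T T t.toNNReal z)) ∂μ) - (∫ z, f z ∂μ) * (∫ z, g z ∂μ);
    let e : Fin N → X → ℝ := fun x z => z.2 x ^ 2 / 2 + P.U (z.1 x) +
      ∑ j : Fin N, ((if j.val = x.val + 1 then P.V (z.1 j - z.1 x) / 2 else 0) +
        (if x.val = j.val + 1 then P.V (z.1 x - z.1 j) / 2 else 0));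
    let G₀ : Matrix (Fin N) (Fin N) ℝ := Matrix.of fun x y => ∫ t in Set.Ioi (0 : ℝ), corr (e x) (e y) t;
    G₀.det ≠ 0 := by
  intro ω₂ lam β γ hω hl hβ hγ T hT N hN P X μ corr e G₀
  have h3 := (det_G₀_ne_zero_iff ω₂ lam β γ hω hl hβ hγ T hT N hN).2.2
  have hpos := Summit.AtomisticToContinuum.FouriersLaw.Theorems.HonestZwanzig.stub_G0PosDef
    ω₂ lam β γ hω hl hβ hγ T hT N hN
  dsimp only at h3 hpos
  refine h3.mpr fun ξ hξ => ?_
  have key := hpos ξ hξ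
  simpa only [zero_mul, neg_zero, Real.exp_zero, one_mul, Matrix.of_apply] using key

/-- **Every orthogonal DC response exists at fixed `N` (unconditional).** For `pinnedChain` (all `> 0`), `T > 0`,
`N ≥ 2` and EVERY `b : Fin N`: `schur_s(j_b, J) → schur₀(j_b, J)` as `s ↓ 0`, where
`schur₀(f,g) = ∫₀^∞corr(f,g) − Σ_{x,y}∫₀^∞corr(f,e_x)·(G₀⁻¹)_{xy}·∫₀^∞corr(e_y,g)` is the explicit finite-`N` Schur complement of
time-integrated equilibrium correlations (`Negative.ExistenceBarrier.tendsto_schur_bond`, p126176, fed `stub_detG0NeZero`).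
In particular the existence clause of `OrthogonalOhm` for the bond responses holds at every `N`. -/
theorem tendsto_schur_bond_all (ω₂ lam β γ : ℝ) (hω : 0 < ω₂) (hl : 0 < lam) (hβ : 0 < β) (hγ : 0 < γ)
    (T : ℝ) (hT : 0 < T) (N : ℕ) (hN : 2 ≤ N) :
    let P := Literature.MathematicalPhysics.KineticTheory.HeatConduction.pinnedChain ω₂ lam β γ
    let X := Literature.MathematicalPhysics.KineticTheory.HeatConduction.PhaseSpace N
    let μ : MeasureTheory.Measure X := P.gibbsMeasure N T
    let corr : (X → ℝ) → (X → ℝ) → ℝ → ℝ := fun f g t =>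
      (∫ z, f z * (∫ y, g y ∂(P.transitionKernel N T T t.toNNReal z)) ∂μ) - (∫ z, f z ∂μ) * (∫ z, g z ∂μ)
    let lap : ℝ → (X → ℝ) → (X → ℝ) → ℝ := fun s f g =>
      ∫ t in Set.Ioi (0 : ℝ), Real.exp (-(s * t)) * corr f g t
    let e : Fin N → X → ℝ := fun x z => z.2 x ^ 2 / 2 + P.U (z.1 x) +
      ∑ j : Fin N, ((if j.val = x.val + 1 then P.V (z.1 j - z.1 x) / 2 else 0) +
        (if x.val = j.val + 1 then P.V (z.1 x - z.1 j) / 2 else 0))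
    let G : ℝ → Matrix (Fin N) (Fin N) ℝ := fun s => Matrix.of fun x y => lap s (e x) (e y)
    let schur : ℝ → (X → ℝ) → (X → ℝ) → ℝ := fun s f g =>
      lap s f g - ∑ x : Fin N, ∑ y : Fin N, lap s f (e x) * (G s)⁻¹ x y * lap s (e y) g
    let J : X → ℝ := fun z => ∑ i : Fin N, P.bondCurrent N i z
    let G₀ : Matrix (Fin N) (Fin N) ℝ := Matrix.of fun x y => ∫ t in Set.Ioi (0 : ℝ), corr (e x) (e y) t
    let schur₀ : (X → ℝ) → (X → ℝ) → ℝ := fun f g =>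
      (∫ t in Set.Ioi (0 : ℝ), corr f g t) -
        ∑ x : Fin N, ∑ y : Fin N, (∫ t in Set.Ioi (0 : ℝ), corr f (e x) t) * G₀⁻¹ x y *
          (∫ t in Set.Ioi (0 : ℝ), corr (e y) g t)
    ∀ b : Fin N,
      Filter.Tendsto (fun s => schur s (P.bondCurrent N b) J) (nhdsWithin (0 : ℝ) (Set.Ioi 0))
        (nhds (schur₀ (P.bondCurrent N b) J)) := by
  intro P X μ corr lap e G schur J G₀ schur₀ b
  have hex := tendsto_schur_bond ω₂ lam β γ hω hl hβ hγ T hT N hN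
  have hdet := stub_detG0NeZero ω₂ lam β γ hω hl hβ hγ T hT N hN
  dsimp only at hex hdet
  exact hex hdet b

/-- **Crux #3 ≡ its existence-free NORMAL FORM, unconditionally.** `PositiveMemory ↔ (∃ k₀ > 0, ∃ R, ∀ N ≥ 2,
∀ R-bulk b, k₀ ≤ schur₀(j_b, J))` — the refuter's `positiveMemory_iff_schur₀Floor` (p126176) with its fixed-`N`
non-degeneracy hypothesis discharged by `stub_detG0NeZero`. The crux is therefore LITERALLY an `N`-uniform positivity
statement about an explicit finite-`N` Schur complement of Green–Kubo-type integrals (what equilibrium MD measures: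
Cruxes/PositiveMemory/NOTES.md, cycle 9); its existence guard is vacuity-free at every `N`. -/
theorem positiveMemory_iff_schur0Floor :
    Summit.AtomisticToContinuum.FouriersLaw.Theses.HonestZwanzig.PositiveMemory ↔
    (∀ ω₂ lam β γ : ℝ, 0 < ω₂ → 0 < lam → 0 < β → 0 < γ → ∀ T : ℝ, 0 < T → ∃ k₀ : ℝ, 0 < k₀ ∧ ∃ R : ℕ,
      ∀ N : ℕ, 2 ≤ N →
      let P := Literature.MathematicalPhysics.KineticTheory.HeatConduction.pinnedChain ω₂ lam β γ
      let X := Literature.MathematicalPhysics.KineticTheory.HeatConduction.PhaseSpace N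
      let μ : MeasureTheory.Measure X := P.gibbsMeasure N T
      let corr : (X → ℝ) → (X → ℝ) → ℝ → ℝ := fun f g t =>
        (∫ z, f z * (∫ y, g y ∂(P.transitionKernel N T T t.toNNReal z)) ∂μ) - (∫ z, f z ∂μ) * (∫ z, g z ∂μ)
      let e : Fin N → X → ℝ := fun x z => z.2 x ^ 2 / 2 + P.U (z.1 x) +
        ∑ j : Fin N, ((if j.val = x.val + 1 then P.V (z.1 j - z.1 x) / 2 else 0) +
          (if x.val = j.val + 1 then P.V (z.1 x - z.1 j) / 2 else 0))
      let J : X → ℝ := fun z => ∑ i : Fin N, P.bondCurrent N i z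
      let G₀ : Matrix (Fin N) (Fin N) ℝ := Matrix.of fun x y => ∫ t in Set.Ioi (0 : ℝ), corr (e x) (e y) t
      let schur₀ : (X → ℝ) → (X → ℝ) → ℝ := fun f g =>
        (∫ t in Set.Ioi (0 : ℝ), corr f g t) -
          ∑ x : Fin N, ∑ y : Fin N, (∫ t in Set.Ioi (0 : ℝ), corr f (e x) t) * G₀⁻¹ x y *
            (∫ t in Set.Ioi (0 : ℝ), corr (e y) g t)
      ∀ b : Fin N, R ≤ b.val → b.val + 2 + R ≤ N → k₀ ≤ schur₀ (P.bondCurrent N b) J) :=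
  positiveMemory_iff_schur₀Floor stub_detG0NeZero

end Summit.AtomisticToContinuum.FouriersLaw.Theorems.HonestZwanzig.PositiveMemory

end
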